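import Literature.Topology.PlanarFoliations.HugStep
import HarnessLib

/-!
# The hugged walk is eventually periodic

Topic: Topology / PlanarFoliations, sequel to `HugWalk.lean`, `HugStep.lean`. All states of the
hugged walk are good (`HugData.good_seq`), so each state is the canonical next state of the
previous one, a function of its out-dart (`HugData.next_eq_of_outDart_eq`); the darts are finitely
many (`Dart.finite`), so a dart repeats and **the sequence of states is eventually periodic,
literally** (`HugData.exists_period`); a minimal period has **pairwise distinct darts**
(`HugData.exists_min_period`). Shifting the start to the periodic part gives a **closed walk of the
separatrix graph turning to the side `s`** (`HugData.pJ`, `HugData.pℓ`, `pJ_period`, `pℓ_turn`,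
`continuous_toLeafSpace_pℓ`) whose incoming star vertical at the first junction is crossed by the
chain on the side `s` (`HugData.cross_pJ`) — the input of the winding argument (`HugWinding`).

## References

* C. Camacho, A. Lins Neto, *Geometric Theory of Foliations*, Birkhäuser (1985), Ch. VII §2
  [CamachoLinsNeto1985].
-/

noncomputable section

open Set Filter Function Metric unitInterval
open _root_.Topology
open Literature.Topology.FourManifolds Literature.Topology.FourManifolds.Foliation

namespace Literature.Topology.PlanarFoliations

namespace StarData

variable {X : Type*} [TopologicalSpace X] [T2Space X] [SecondCountableTopology X] [Nonempty X] {F : Foliation ℝ X} {ι : X → ℂ}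
variable {B : Type*} [NormedAddCommGroup B] [NormedSpace ℝ B] {M : Type*} [TopologicalSpace M] {T : Foliation B M} {g : ℂ → M}
variable {D : StarData F ι T g} {hbi : IsBiOriented F} {hι : IsOpenEmbedding ι} {K : ℕ → X} {H : D.HugHyp hbi hι K}

namespace HugData

variable (ho : F.IsTransverselyOriented) {s : ℝ} (d₀ : HugData H)

omit [NormedSpace ℝ B] in
/-- Equal states have equal successors. [folklore] -/
theorem seq_succ_congr (s : ℝ) {k k' : ℕ} (h : seq s d₀ k = seq s d₀ k') : seq s d₀ (k + 1) = seq s d₀ (k' + 1) := by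
  rw [seq_succ, seq_succ, h]

omit [NormedSpace ℝ B] in
/-- Equal states have equal futures. [folklore] -/
theorem seq_add_congr (s : ℝ) {k k' : ℕ} (h : seq s d₀ k = seq s d₀ k') (i : ℕ) : seq s d₀ (k + i) = seq s d₀ (k' + i) := by
  induction i with
  | zero => exact h
  | succ i ih => exact seq_succ_congr d₀ s ih

include ho in
/-- **The sequence of states of the hugged walk is eventually periodic** (literally): a dart
repeats, the next states coincide, and so do all later ones. [folklore] -/
theorem exists_period (hs : s = 1 ∨ s = -1) (hcross : d₀.Cross s) :
    ∃ c p : ℕ, 0 < p ∧ ∀ i, seq s d₀ (c + i + p) = seq s d₀ (c + i) := by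
  haveI := Dart.finite (D := D)
  have aux : ∀ {a b : ℕ}, a < b → (seq s d₀ a).dart = (seq s d₀ b).dart →
      ∃ c p : ℕ, 0 < p ∧ ∀ i, seq s d₀ (c + i + p) = seq s d₀ (c + i) := by
    intro a b hab heq
    have hout : (seq s d₀ a).outDart s = (seq s d₀ b).outDart s := by
      show (seq s d₀ a).dart.turn s = (seq s d₀ b).dart.turn s
      rw [heq]
    have h1 : seq s d₀ (a + 1) = seq s d₀ (b + 1) :=
      outDart_seq_succ_eq s d₀ hout (good_seq ho d₀ hs hcross a) (good_seq ho d₀ hs hcross b)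
    refine ⟨a + 1, b - a, Nat.sub_pos_of_lt hab, fun i ↦ ?_⟩
    have : a + 1 + i + (b - a) = b + 1 + i := by omega
    rw [this]
    exact (seq_add_congr d₀ s h1 i).symm
  obtain ⟨a, b, hab, heq⟩ := Finite.exists_ne_map_eq_of_infinite (fun k : ℕ ↦ (seq s d₀ k).dart)
  rcases lt_or_gt_of_ne hab with h | h
  · exact aux h heq
  · exact aux h heq.symm

include ho in
/-- **A minimal period of the hugged walk has pairwise distinct darts.** [folklore] -/
theorem exists_min_period (hs : s = 1 ∨ s = -1) (hcross : d₀.Cross s) :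
    ∃ c p : ℕ, 0 < p ∧ (∀ i, seq s d₀ (c + i + p) = seq s d₀ (c + i)) ∧
      ∀ i j, i < j → j < p → (seq s d₀ (c + i)).dart ≠ (seq s d₀ (c + j)).dart := by
  classical
  have hex : ∃ p, ∃ c : ℕ, 0 < p ∧ ∀ i, seq s d₀ (c + i + p) = seq s d₀ (c + i) := by
    obtain ⟨c, p, hp, hper⟩ := exists_period ho d₀ hs hcross
    exact ⟨p, c, hp, hper⟩
  set p := Nat.find hex with hpdef
  obtain ⟨c, hp, hper⟩ : ∃ c : ℕ, 0 < p ∧ ∀ i, seq s d₀ (c + i + p) = seq s d₀ (c + i) := Nat.find_spec hex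
  refine ⟨c, p, hp, hper, fun i j hij hjp heq ↦ ?_⟩
  -- a repetition inside the period gives a shorter period
  have hout : (seq s d₀ (c + i)).outDart s = (seq s d₀ (c + j)).outDart s := by
    show (seq s d₀ (c + i)).dart.turn s = (seq s d₀ (c + j)).dart.turn s
    rw [heq]
  have h1 : seq s d₀ (c + i + 1) = seq s d₀ (c + j + 1) :=
    outDart_seq_succ_eq s d₀ hout (good_seq ho d₀ hs hcross _) (good_seq ho d₀ hs hcross _)
  have hmin : ¬ (j - i < p ∧ ∃ c' : ℕ, 0 < j - i ∧ ∀ k, seq s d₀ (c' + k + (j - i)) = seq s d₀ (c' + k)) := by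
    rintro ⟨hlt, hP⟩
    exact Nat.find_min hex hlt hP
  refine hmin ⟨by omega, c + i + 1, Nat.sub_pos_of_lt hij, fun k ↦ ?_⟩
  have : c + i + 1 + k + (j - i) = c + j + 1 + k := by omega
  rw [this]
  exact (seq_add_congr d₀ s h1 k).symm

/-! ## The periodic walk -/

variable (s) (hs : s = 1 ∨ s = -1) (c : ℕ)

/-- **The junctions of the periodic part** of the hugged walk, from the index `c`. [folklore] -/
def pJ (i : ℕ) : D.WalkJunction hι := hugJ s d₀ (c + i)

/-- **The links of the periodic part** of the hugged walk, from the index `c`. [folklore] -/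
def pℓ (i : ℕ) : Path (pJ s d₀ c i).Kout.base (pJ s d₀ c (i + 1)).Kin.base := hugLink s hs d₀ (c + i)

omit [NormedSpace ℝ B] in
/-- The junctions of the periodic part, unfolded. [folklore] -/
theorem pJ_apply (i : ℕ) : pJ s d₀ c i = (seq s d₀ (c + i)).junction s := rfl

omit [NormedSpace ℝ B] in
/-- The links of the periodic part, unfolded. [folklore] -/
theorem pℓ_apply (i : ℕ) (θ : I) : pℓ s d₀ hs c i θ = hugLink s hs d₀ (c + i) θ := rfl

omit [NormedSpace ℝ B] in
/-- **The periodic walk turns to the side `s`.** [folklore] -/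
theorem pJ_turn (i : ℕ) : (pJ s d₀ c i).jout = (pJ s d₀ c i).turn s := rfl

omit [NormedSpace ℝ B] in
/-- **The periodic walk closes up** after a period. [folklore] -/
theorem pJ_period {p : ℕ} (hper : ∀ i, seq s d₀ (c + i + p) = seq s d₀ (c + i)) : pJ s d₀ c p = pJ s d₀ c 0 := by
  show (seq s d₀ (c + p)).junction s = (seq s d₀ (c + 0)).junction s
  have h := hper 0
  rw [Nat.add_zero] at h ⊢
  rw [h]

omit [NormedSpace ℝ B] in
/-- The periodic walk is periodic in all its junctions. [folklore] -/
theorem pJ_add {p : ℕ} (hper : ∀ i, seq s d₀ (c + i + p) = seq s d₀ (c + i)) (i : ℕ) : pJ s d₀ c (i + p) = pJ s d₀ c i := by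
  show (seq s d₀ (c + (i + p))).junction s = (seq s d₀ (c + i)).junction s
  rw [← Nat.add_assoc, hper i]

include ho in
/-- **All links of the periodic walk are continuous in the leaf topology.** [folklore] -/
theorem continuous_toLeafSpace_pℓ (hcross : d₀.Cross s) (i : ℕ) :
    Continuous (toLeafSpace ∘ pℓ s d₀ hs c i : I → F.LeafSpace) :=
  continuous_toLeafSpace_hugLink' ho d₀ hs hcross (c + i)

include ho in
/-- The points of the link `i` of the periodic walk are on the leaf of the state `c + i + 1`.
[folklore] -/
theorem pℓ_mem_leaf (hcross : d₀.Cross s) (i : ℕ) (θ : I) : pℓ s d₀ hs c i θ ∈ F.leaf (seq s d₀ (c + i + 1)).st.y :=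
  hugLink_mem_leaf s hs d₀ (good_seq ho d₀ hs hcross (c + i)) θ

include ho in
/-- The link `i` of the periodic walk is the leaf-arc link of the state `c + i`. [folklore] -/
theorem pℓ_eq_link (hcross : d₀.Cross s) (i : ℕ) (θ : I) :
    pℓ s d₀ hs c i θ = (seq s d₀ (c + i)).link s (good_seq ho d₀ hs hcross (c + i)) θ :=
  hugLink_apply_of_good s hs d₀ (good_seq ho d₀ hs hcross (c + i)) θ

include ho hs in
/-- **The chain crosses the incoming vertical of the first junction of the periodic walk on the
side `s`.** [folklore] -/
theorem cross_pJ (hcross : d₀.Cross s) : (seq s d₀ (c + 0)).Cross s := cross_seq' ho d₀ hs hcross _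

end HugData

end StarData

end Literature.Topology.PlanarFoliations
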